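import Literature.AlgebraicGeometry.Frobenioids.ProfiniteUnitsNaturality
import HarnessLib

/-!
# Frobenioids I, Definition 2.8 (ii): the pro-`l` projections and assembling an element from its components — proofs

Mochizuki, *The geometry of Frobenioids I*, Kyushu J. Math. **62** (2008), §2, Def. 2.8 (ii),
kurims p. 52 [cite: MochizukiFrdI2008, Def. 2.8(ii) p.52], and its use in the proof of Prop. 5.6,
p. 107: "since we have a natural isomorphism `∏_p O^×(A)[p] ⥲ O^×(A)` … we then take `u` to be the
'infinite product' of the `u_p`".  Over `ProLDecomposition_holds` this file provides, as theorems
(no new definitions):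

* `IsTfgProfinite.exists_proLProjections` — the projections `π_p : M → M[p]` onto the pro-`p`
  portions: homomorphisms with `x = ∏'_p π_p(x)`, `π_p = id` on `M[p]`, `π_p = 1` on `M[q]`, `q ≠ p`;
* `IsTfgProfinite.eq_of_proj_eq` — an element is determined by its components;
* `IsTfgProfinite.exists_hasProd_of_mem_proL` — conversely every family `(w_p ∈ M[p])_p` is the family
  of components of a (unique) element `u = ∏'_p w_p` (compactness: the partial products are
  eventually constant modulo every open subgroup).

Part of the dossier for [FrdI] Prop. 5.6 (pool item D-θ of the abc-iut cell).
-/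

namespace Literature.AlgebraicGeometry.Frobenioids

open _root_.Topology Filter

universe u

namespace IsTfgProfinite

variable {M : Type u} [CommGroup M] [TopologicalSpace M]

/-- An element of `M[p]` lies in every open subgroup of index prime to `p`.
[cite: MochizukiFrdI2008, Def. 2.8(ii) p.52] -/
theorem mem_of_mem_proL_of_not_dvd (h : IsTfgProfinite M) {p : Nat.Primes} {y : M}
    (hy : y ∈ proL M p) (U : OpenSubgroup M) (hp : ¬ (p : ℕ) ∣ (U : Subgroup M).index) : y ∈ U := by
  have := h.pow_ordProj_index_mem hy U
  rwa [Nat.factorization_eq_zero_of_not_dvd hp, pow_zero, pow_one] at this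

/-- **The pro-`p` projections** (Def. 2.8 (ii)): there are homomorphisms `π_p : M → M` with values in
`M[p]` such that every `x` is the convergent product `∏'_p π_p(x)`, `π_p` is the identity on `M[p]`
and trivial on `M[q]` for `q ≠ p`. [cite: MochizukiFrdI2008, Def. 2.8(ii) p.52] -/
theorem exists_proLProjections (h : IsTfgProfinite M) :
    ∃ π : Nat.Primes → (M →* M), (∀ p x, π p x ∈ proL M p) ∧ (∀ x, HasProd (fun p => π p x) x) ∧
      (∀ p, ∀ y ∈ proL M p, π p y = y) ∧ (∀ p q : Nat.Primes, q ≠ p → ∀ y ∈ proL M q, π p y = 1) := by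
  classical
  haveI := h.isTopologicalGroup
  have hdec := ProLDecomposition_holds M h
  choose c hc huniq using hdec
  -- `hc x : (∀ l, c x l ∈ proL M l) ∧ Multipliable (c x) ∧ ∏' l, c x l = x`
  haveI := h.t2Space
  have hprod : ∀ x, HasProd (c x) x := fun x => by
    have := (hc x).2.1.hasProd
    rwa [(hc x).2.2] at this
  have hmul : ∀ x y, c (x * y) = fun l => c x l * c y l := by
    intro x y
    symm
    refine huniq (x * y) _ ⟨fun l => (proL M l).mul_mem ((hc x).1 l) ((hc y).1 l),
      ((hprod x).mul (hprod y)).multipliable, ((hprod x).mul (hprod y)).tprod_eq⟩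
  have hsingle : ∀ (p : Nat.Primes) (y : M), y ∈ proL M p →
      c y = fun l => if l = p then y else 1 := by
    intro p y hy
    symm
    refine huniq y _ ⟨fun l => ?_, (hasProd_ite_eq p y).multipliable, (hasProd_ite_eq p y).tprod_eq⟩
    by_cases hl : l = p
    · subst hl; simpa using hy
    · simp [hl, (proL M l).one_mem]
  refine ⟨fun p => MonoidHom.mk' (fun x => c x p) (fun x y => by rw [hmul]), fun p x => (hc x).1 p,
    fun x => hprod x, fun p y hy => ?_, fun p q hqp y hy => ?_⟩
  · show c y p = y
    rw [hsingle p y hy]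
    exact if_pos rfl
  · show c y p = 1
    rw [hsingle q y hy]
    exact if_neg (Ne.symm hqp)

/-- An element of a tfg profinite abelian group is determined by its pro-`p` components.
[cite: MochizukiFrdI2008, Def. 2.8(ii) p.52] -/
theorem eq_of_proj_eq (h : IsTfgProfinite M) {π : Nat.Primes → (M →* M)}
    (hπ : ∀ x, HasProd (fun p => π p x) x) {x y : M} (hxy : ∀ p, π p x = π p y) : x = y := by
  haveI := h.t2Space
  have hx := hπ x
  simp_rw [hxy] at hx
  exact hx.unique (hπ y)

/-- **Assembling an element from prescribed components** ("we then take `u` to be the 'infinite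
product' of the `u_p`", [FrdI] p. 107): a family `(w_p)_p` with `w_p ∈ M[p]` has a convergent
product in a tfg profinite abelian group — modulo an open subgroup `U` the partial products are
eventually constant (`w_p ∈ U` for `p ∤ [M:U]`), and a cluster point (compactness) is then the limit.
[cite: MochizukiFrdI2008, Prop. 5.6 p.107] -/
theorem exists_hasProd_of_mem_proL (h : IsTfgProfinite M) (w : Nat.Primes → M)
    (hw : ∀ p, w p ∈ proL M p) : ∃ u : M, HasProd w u := by
  classical
  haveI := h.isTopologicalGroup
  haveI := h.compactSpace
  let s : Finset Nat.Primes → M := fun F => ∏ p ∈ F, w p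
  -- modulo an open subgroup the partial products are eventually constant
  have hconst : ∀ U : OpenSubgroup M, ∃ F₀ : Finset Nat.Primes, ∀ F, F₀ ≤ F → (s F₀)⁻¹ * s F ∈ U := by
    intro U
    let F₀ : Finset Nat.Primes := ((U : Subgroup M).index.primeFactors).attach.image
      fun q => (⟨q.1, Nat.prime_of_mem_primeFactors q.2⟩ : Nat.Primes)
    have hF₀ : ∀ p : Nat.Primes, (p : ℕ) ∣ (U : Subgroup M).index → p ∈ F₀ := fun p hdvd =>
      Finset.mem_image.mpr ⟨⟨p.1, Nat.mem_primeFactors.mpr ⟨p.2, hdvd, h.index_ne_zero U⟩⟩,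
        Finset.mem_attach _ _, Subtype.ext rfl⟩
    refine ⟨F₀, fun F hF => ?_⟩
    have : s F = s F₀ * ∏ p ∈ F \ F₀, w p := by
      simp only [s]
      rw [mul_comm, Finset.prod_sdiff hF]
    rw [this, inv_mul_cancel_left]
    refine U.toSubgroup.prod_mem fun p hp => ?_
    exact h.mem_of_mem_proL_of_not_dvd (hw p) U fun hdvd => (Finset.mem_sdiff.mp hp).2 (hF₀ p hdvd)
  -- a cluster point of the partial products
  obtain ⟨u, hu⟩ := exists_clusterPt_of_compactSpace (map s atTop)
  refine ⟨u, ?_⟩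
  rw [HasProd, SummationFilter.unconditional_filter, tendsto_atTop']
  intro W hW
  obtain ⟨U, hU⟩ := h.exists_openSubgroup_mul_subset hW
  obtain ⟨F₀, hF₀⟩ := hconst U
  -- the partial products visit `u • U` beyond `F₀`, hence stay there
  have hopen : IsOpen ((fun y => u⁻¹ * y) ⁻¹' (U : Set M)) :=
    U.isOpen.preimage (continuous_const.mul continuous_id)
  have huU : u ∈ (fun y => u⁻¹ * y) ⁻¹' (U : Set M) := by
    show u⁻¹ * u ∈ (U : Set M)
    rw [inv_mul_cancel]
    exact U.one_mem
  have hfreq : ∃ᶠ F in atTop, s F ∈ (fun y => u⁻¹ * y) ⁻¹' (U : Set M) :=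
    (mapClusterPt_iff_frequently.mp hu) _ (hopen.mem_nhds huU)
  obtain ⟨F₁, hF₁U, hF₁⟩ := (hfreq.and_eventually (eventually_ge_atTop F₀)).exists
  refine ⟨F₀, fun F hF => ?_⟩
  have hmem : u⁻¹ * s F ∈ U := by
    have e : u⁻¹ * s F = (u⁻¹ * s F₁) * ((s F₀)⁻¹ * s F₁)⁻¹ * ((s F₀)⁻¹ * s F) := by group
    rw [e]
    exact U.mul_mem (U.mul_mem hF₁U (U.inv_mem (hF₀ F₁ hF₁))) (hF₀ F hF)
  simpa only [mul_inv_cancel_left] using hU _ hmem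

/-- The element assembled from components `w_p ∈ M[p]` has `p`-component `w_p`.
[cite: MochizukiFrdI2008, Prop. 5.6 p.107] -/
theorem proj_eq_of_hasProd (h : IsTfgProfinite M) {π : Nat.Primes → (M →* M)}
    (hπid : ∀ p, ∀ y ∈ proL M p, π p y = y) (hπzero : ∀ p q : Nat.Primes, q ≠ p → ∀ y ∈ proL M q, π p y = 1)
    {w : Nat.Primes → M} (hw : ∀ p, w p ∈ proL M p) {u : M} (hu : HasProd w u) (p : Nat.Primes) :
    π p u = w p := by
  classical
  haveI := h.isTopologicalGroup
  haveI := h.t2Space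
  have hc : Continuous (π p) := h.continuous_monoidHom h (π p)
  have h1 : HasProd ((π p) ∘ w) (π p u) := hu.map (π p) hc
  have h2 : (π p) ∘ w = fun q => if q = p then w p else 1 := by
    funext q
    by_cases hq : q = p
    · subst hq; simp [hπid q (w q) (hw q)]
    · simp [hq, hπzero p q hq (w q) (hw q)]
  rw [h2] at h1
  exact h1.unique (hasProd_ite_eq p (w p))

end IsTfgProfinite

end Literature.AlgebraicGeometry.Frobenioids
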